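import Literature.Geometry.Riemannian.RicciFlowScalarMaximumPrinciple
import Literature.Geometry.Riemannian.CurvatureNormSq
import Literature.Geometry.Riemannian.PerelmanEntropyCutoff
import Literature.Geometry.Lorentzian.EnergyCurrents
import Summits.SmoothPoincare4.SmoothPoincare4.Theorems.EntropyRungChangGurskyYangStubRoundnessRateAux
import Mathlib.Analysis.SpecialFunctions.Pow.Deriv
import HarnessLib

/-!
# Decay of `|∇R|²` under the Type-I sandwich (Hamilton 1982, Lemma 17.4)
(helper `helper_gradientDecay_of_evolution` of stub `stub_gradientEstimates` of line
`margerin-cone-hamilton-rails`, crux `EntropyRung.ChangGurskyYang`, item stmt-SmoothPoincare4-10834)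

Piece H4 of Hamilton 1982, §17, Lemma 17.4 in unnormalised clothes: along a Ricci flow on `[0, T)`
on a closed 4-manifold with the invariant pinching `m ≤ R`, `|W|² + 2|E|² ≤ K R^{2−τ}`
(`0 < τ ≤ 1`) and the Type-I sandwich `c₁ ≤ (T−t)R ≤ c₂` on `[t₁, T)`, the gradient of the
scalar curvature decays one order better than scaling: `|∇R|² ≤ C (T−t)^{τ−3}` on `[t₁, T)`.
The maximum-principle ENDGAME is proved here, GIVEN as hypotheses (they are the other pieces
H0–H2 of the stub) the space-time regularity of `R`, `|∇R|²`, `|Ric|²` along the restarted flows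
`s ↦ g(s + t₁)` and Hamilton's evolution inequality for
`F = |∇R|²/R + N(|Ric|² − R²/4)`, `N = 180(1+Λ)`,
`∂ₜF ≤ ΔF − |∇R|² + N(64|Rm| + R)|E|²` whenever `|E|² ≤ ΛR²`.

Proof (`helper_gradientDecay_of_evolution`): `Λ = Km^{−τ}/2` makes `|E|² ≤ ΛR²`
(`tracefree_le_mul_sq`); the reaction term is `≤ −(c₁/(T−t))F + C₃(T−t)^{τ−3}`
(`reaction_bound`: `−|∇R|² = −RF + NR|E|²`, `F ≥ 0`, `R ≥ c₁/(T−t)`, `|Rm| ≤ c R`,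
`|E|² ≤ (K/2)R^{2−τ}`, `R ≤ c₂/(T−t)`); the weak maximum principle `weakMaximumPrinciple`
(Topping 2006, Thm. 3.1.1) on `[0, t − t₁]` for the restarted flow with `X = 0`,
`F_ode(r, s) = −(c₁/(T−t₁−s))r + C₃(T−t₁−s)^{τ−3}` and the explicit solution
`φ(s) = A(T−t₁−s)^{τ−2} + B(T−t₁−s)^{c₁}`, `A = C₃/(2−τ+c₁)`, `φ(0) = max F(·, t₁)`
(`decay_comparison`) gives `F ≤ C₄(T−t)^{τ−2}`, whence `|∇R|² ≤ RF ≤ c₂C₄(T−t)^{τ−3}`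
(`gradSq_le_of_window`): `δ = τ`.

## References

* R. S. Hamilton, *Three-manifolds with positive Ricci curvature*, J. Differential Geom. 17
  (1982) 255–306, §17, Lemma 17.4 (and §11, Thm. 11.1). [Hamilton1982]
* P. Topping, *Lectures on the Ricci flow*, LMS Lecture Note Series 325, CUP 2006, Thm. 3.1.1.
  [Topping2006]
-/

noncomputable section

-- every `Summit.SmoothPoincare4.SmoothPoincare4.…` name repeats the summit = sub-problem segment (D-0017 layout)
set_option linter.dupNamespace false

open Set Function Filter
open scoped Manifold ContDiff Topology

namespace Summit.SmoothPoincare4.SmoothPoincare4.Theorems.MargerinRails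

open Literature.Geometry.Riemannian
open Literature.Geometry.Lorentzian Literature.Geometry.Lorentzian.PseudoRiemannianMetric

/-! ### Real-variable lemmas: the reaction term and the comparison ODE -/

section RealLemmas

/-- `R^{2−τ} ≤ m^{−τ} R²` for `R ≥ m > 0`, `τ ≥ 0`. [folklore] -/
theorem rpow_two_sub_le_of_le {m R τ : ℝ} (hm : 0 < m) (hmR : m ≤ R) (hτ : 0 ≤ τ) :
    R ^ (2 - τ) ≤ m ^ (-τ) * R ^ 2 := by
  have hR0 : 0 < R := hm.trans_le hmR
  rw [Real.rpow_sub hR0, Real.rpow_two, div_eq_mul_inv, ← Real.rpow_neg hR0.le, mul_comm]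
  exact mul_le_mul_of_nonneg_right (Real.rpow_le_rpow_of_nonpos hm hmR (by linarith))
    (sq_nonneg _)

/-- The pinching `|W|² + 2|E|² ≤ K R^{2−τ}`, `|W|² ≥ 0`, `R ≥ m > 0` gives `|E|² ≤ Λ R²` with
`Λ = K m^{−τ}/2` (Hamilton 1982, §17, proof of Lemma 17.4: `|E|²/R² → 0`).
[cite: Hamilton1982, §17, Lemma 17.4] -/
theorem tracefree_le_mul_sq {K m τ R E₂ W₂ : ℝ} (hm : 0 < m) (hK : 0 ≤ K) (hτ : 0 ≤ τ)
    (hmR : m ≤ R) (hW : 0 ≤ W₂) (hp : W₂ + 2 * E₂ ≤ K * R ^ (2 - τ)) :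
    E₂ ≤ K * m ^ (-τ) / 2 * R ^ 2 := by
  have := mul_le_mul_of_nonneg_left (rpow_two_sub_le_of_le hm hmR hτ) hK
  linarith

/-- **The reaction term of Hamilton's `F`** (Hamilton 1982, §17, proof of Lemma 17.4, with §11,
Thm. 11.1): with `F = V/R + N|E|²`, `N = 180(1+Λ)`, `|E|² = |Ric|² − R²/4 ≥ 0`, `V = |∇R|² ≥ 0`,
`|W|² = |Rm|² − 2|Ric|² + R²/3 ≥ 0`, `|W|² + 2|E|² ≤ K R^{2−τ}`, `R ≥ m > 0` and the sandwich
`c₁ ≤ dR ≤ c₂` (`d = T − t > 0`), the reaction term satisfies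
`−V + N(64|Rm| + R)|E|² ≤ −(c₁/d) F + C₃ d^{τ−3}` for a constant `C₃ = C₃(K, m, τ, Λ, c₂) ≥ 0`:
`−V = −RF + NR|E|² ≤ −(c₁/d)F + NR|E|²`, `|Rm| ≤ (Km^{−τ} + 1/6)^{1/2} R`,
`|E|² ≤ (K/2)R^{2−τ}`, `R^{3−τ} ≤ c₂^{3−τ} d^{τ−3}`. [cite: Hamilton1982, §17, Lemma 17.4] -/
theorem reaction_bound {K m τ Λ c₁ : ℝ} (c₂ : ℝ) (hm : 0 < m) (hK : 0 < K) (hτ0 : 0 < τ)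
    (hτ1 : τ ≤ 1) (hΛ : 0 ≤ Λ) (hc₁ : 0 < c₁) :
    ∃ C₃ : ℝ, 0 ≤ C₃ ∧ ∀ R V P Q d : ℝ, m ≤ R → 0 ≤ V → 0 ≤ P - R ^ 2 / 4 →
      0 ≤ Q - 2 * P + R ^ 2 / 3 → (Q - 2 * P + R ^ 2 / 3) + 2 * (P - R ^ 2 / 4) ≤ K * R ^ (2 - τ) →
      0 < d → c₁ ≤ d * R → d * R ≤ c₂ →
      -V + 180 * (1 + Λ) * (64 * Real.sqrt Q + R) * (P - R ^ 2 / 4) ≤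
        -(c₁ / d) * (V / R + 180 * (1 + Λ) * (P - R ^ 2 / 4)) + C₃ * d ^ (τ - 3) := by
  set A : ℝ := K * m ^ (-τ) + 1 / 6 with hA
  have hA0 : 0 ≤ A := by positivity
  set cQ : ℝ := Real.sqrt A with hcQ
  have hcQ0 : 0 ≤ cQ := Real.sqrt_nonneg _
  set Nc : ℝ := 180 * (1 + Λ) with hNc
  have hNc0 : 0 ≤ Nc := by positivity
  set C₂ : ℝ := Nc * (64 * cQ + 2) * (K / 2) with hC₂
  have hC₂0 : 0 ≤ C₂ := by positivity
  refine ⟨C₂ * |c₂| ^ (3 - τ), by positivity, ?_⟩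
  intro R V P Q d hmR hV hE hW hp hd hc₁R hRc₂
  have hR0 : 0 < R := hm.trans_le hmR
  have hc₂0 : 0 < c₂ := by linarith
  set E₂ : ℝ := P - R ^ 2 / 4 with hE₂
  -- `F ≥ 0` and `R ≥ c₁ / d`
  have hu0 : 0 ≤ V / R + Nc * E₂ := add_nonneg (div_nonneg hV hR0.le) (mul_nonneg hNc0 hE)
  have hcR : c₁ / d ≤ R := by rw [div_le_iff₀ hd]; linarith
  have h2 : -R * (V / R + Nc * E₂) ≤ -(c₁ / d) * (V / R + Nc * E₂) :=
    mul_le_mul_of_nonneg_right (neg_le_neg hcR) hu0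
  -- `|Rm| ≤ cQ R` and `|E|² ≤ (K/2) R^{2-τ}`
  have hrpow : R ^ (2 - τ) ≤ m ^ (-τ) * R ^ 2 := rpow_two_sub_le_of_le hm hmR hτ0.le
  have hQ : Q ≤ A * R ^ 2 := by
    have : K * R ^ (2 - τ) ≤ K * (m ^ (-τ) * R ^ 2) := mul_le_mul_of_nonneg_left hrpow hK.le
    rw [hA]
    linarith
  have hS : Real.sqrt Q ≤ cQ * R := by
    calc Real.sqrt Q ≤ Real.sqrt (A * R ^ 2) := Real.sqrt_le_sqrt hQ
      _ = cQ * R := by rw [Real.sqrt_mul hA0, Real.sqrt_sq hR0.le]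
  have hEle : E₂ ≤ K / 2 * R ^ (2 - τ) := by linarith
  -- the algebra
  have h1 : -V + Nc * (64 * Real.sqrt Q + R) * E₂ =
      -R * (V / R + Nc * E₂) + Nc * (64 * Real.sqrt Q + 2 * R) * E₂ := by
    field_simp
    ring
  have h3 : Nc * (64 * Real.sqrt Q + 2 * R) * E₂ ≤ Nc * ((64 * cQ + 2) * R) * E₂ := by
    have := mul_le_mul_of_nonneg_left hS (mul_nonneg hNc0 hE)
    linarith
  have h4 : Nc * ((64 * cQ + 2) * R) * E₂ ≤ Nc * ((64 * cQ + 2) * R) * (K / 2 * R ^ (2 - τ)) :=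
    mul_le_mul_of_nonneg_left hEle (by positivity)
  have h5 : R * R ^ (2 - τ) = R ^ (3 - τ) := by
    rw [show (3 : ℝ) - τ = 1 + (2 - τ) by ring, Real.rpow_add hR0, Real.rpow_one]
  have h6 : R ^ (3 - τ) ≤ |c₂| ^ (3 - τ) * d ^ (τ - 3) := by
    have hRle : R ≤ c₂ / d := by rw [le_div_iff₀ hd]; linarith
    calc R ^ (3 - τ) ≤ (c₂ / d) ^ (3 - τ) := Real.rpow_le_rpow hR0.le hRle (by linarith)
      _ = |c₂| ^ (3 - τ) * d ^ (τ - 3) := by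
        rw [abs_of_pos hc₂0, Real.div_rpow hc₂0.le hd.le, div_eq_mul_inv,
          ← Real.rpow_neg hd.le, neg_sub]
  have h7 : C₂ * R ^ (3 - τ) ≤ C₂ * (|c₂| ^ (3 - τ) * d ^ (τ - 3)) :=
    mul_le_mul_of_nonneg_left h6 hC₂0
  have h8 : Nc * ((64 * cQ + 2) * R) * (K / 2 * R ^ (2 - τ)) = C₂ * R ^ (3 - τ) := by
    rw [hC₂, ← h5]; ring
  calc -V + Nc * (64 * Real.sqrt Q + R) * E₂
      = -R * (V / R + Nc * E₂) + Nc * (64 * Real.sqrt Q + 2 * R) * E₂ := h1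
    _ ≤ -(c₁ / d) * (V / R + Nc * E₂) + C₂ * R ^ (3 - τ) := by linarith
    _ ≤ -(c₁ / d) * (V / R + Nc * E₂) + C₂ * |c₂| ^ (3 - τ) * d ^ (τ - 3) := by
      rw [mul_assoc]; linarith

/-- **The comparison ODE of Lemma 17.4**: `φ' = −(c₁/(T'−s))φ + C₃(T'−s)^{τ−3}` on `[0, T')` is
solved by `φ(s) = A(T'−s)^{τ−2} + B(T'−s)^{c₁}`, `A = C₃/(2−τ+c₁)`, with any prescribed
`φ(0) = α`, and `φ(s) ≤ C₄ (T'−s)^{τ−2}` (`τ ≤ 1 < 2`, `c₁ > 0`).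
[cite: Hamilton1982, §17, Lemma 17.4] -/
theorem decay_comparison {T' c₁ τ C₃ : ℝ} (hT' : 0 < T') (hc₁ : 0 < c₁) (hτ1 : τ ≤ 1)
    (hC₃ : 0 ≤ C₃) (α : ℝ) :
    ∃ φ : ℝ → ℝ, ∃ C₄ : ℝ, φ 0 = α ∧ 0 ≤ C₄ ∧
      (∀ s < T', HasDerivAt φ (-(c₁ / (T' - s)) * φ s + C₃ * (T' - s) ^ (τ - 3)) s) ∧
      (∀ s, 0 ≤ s → s < T' → φ s ≤ C₄ * (T' - s) ^ (τ - 2)) := by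
  have hden : 0 < 2 - τ + c₁ := by linarith
  set A : ℝ := C₃ / (2 - τ + c₁) with hA
  have hA0 : 0 ≤ A := div_nonneg hC₃ hden.le
  have hAC : A * (2 - τ + c₁) = C₃ := div_mul_cancel₀ C₃ hden.ne'
  have hP1 : 0 < T' ^ c₁ := Real.rpow_pos_of_pos hT' _
  set B : ℝ := (α - A * T' ^ (τ - 2)) / T' ^ c₁ with hB
  refine ⟨fun s ↦ A * (T' - s) ^ (τ - 2) + B * (T' - s) ^ c₁, A + |B| * T' ^ c₁ * T' ^ (2 - τ),
    ?_, add_nonneg hA0 (by positivity), ?_, ?_⟩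
  · simp only [sub_zero]
    rw [hB, div_mul_cancel₀ _ hP1.ne']
    ring
  · intro s hs
    have hd : 0 < T' - s := sub_pos.2 hs
    have hlin : HasDerivAt (fun r : ℝ ↦ T' - r) (-1) s := by
      simpa using (hasDerivAt_id s).const_sub T'
    have h1 := (hlin.rpow_const (p := τ - 2) (Or.inl hd.ne')).const_mul A
    have h2 := (hlin.rpow_const (p := c₁) (Or.inl hd.ne')).const_mul B
    refine (h1.add h2).congr_deriv ?_
    rw [Real.rpow_sub_one hd.ne' (τ - 2), Real.rpow_sub_one hd.ne' c₁,
      show τ - 3 = τ - 2 - 1 by ring, Real.rpow_sub_one hd.ne' (τ - 2), ← hAC]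
    field_simp
    ring
  · intro s hs0 hs
    have hd : 0 < T' - s := sub_pos.2 hs
    have hdT : T' - s ≤ T' := by linarith
    have hY0 : 0 ≤ (T' - s) ^ c₁ := Real.rpow_nonneg hd.le _
    have hY : (T' - s) ^ c₁ ≤ T' ^ c₁ := Real.rpow_le_rpow hd.le hdT hc₁.le
    have hX : T' ^ (τ - 2) ≤ (T' - s) ^ (τ - 2) :=
      Real.rpow_le_rpow_of_nonpos hd hdT (by linarith)
    have hone : T' ^ (2 - τ) * T' ^ (τ - 2) = 1 := by
      rw [← Real.rpow_add hT', show 2 - τ + (τ - 2) = 0 by ring, Real.rpow_zero]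
    have hBY : B * (T' - s) ^ c₁ ≤ |B| * (T' - s) ^ c₁ :=
      mul_le_mul_of_nonneg_right (le_abs_self B) hY0
    have h2 : |B| * (T' - s) ^ c₁ ≤ |B| * T' ^ c₁ := mul_le_mul_of_nonneg_left hY (abs_nonneg B)
    have h4 : |B| * T' ^ c₁ = |B| * T' ^ c₁ * T' ^ (2 - τ) * T' ^ (τ - 2) := by
      rw [mul_assoc (|B| * T' ^ c₁), hone, mul_one]
    have h3 : |B| * T' ^ c₁ * T' ^ (2 - τ) * T' ^ (τ - 2) ≤
        |B| * T' ^ c₁ * T' ^ (2 - τ) * (T' - s) ^ (τ - 2) :=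
      mul_le_mul_of_nonneg_left hX (by positivity)
    show A * (T' - s) ^ (τ - 2) + B * (T' - s) ^ c₁ ≤
      (A + |B| * T' ^ c₁ * T' ^ (2 - τ)) * (T' - s) ^ (τ - 2)
    linarith

/-- The right-hand side `F_ode(r, s) = −(c₁/(T'−s)) r + C₃ (T'−s)^{τ−3}` of the comparison ODE is
`C¹` on `ℝ × [0, w]` for `w < T'`. [folklore] -/
theorem contDiffOn_decayODE {T' c₁ C₃ τ w : ℝ} (hw : w < T') :
    ContDiffOn ℝ 1 (uncurry fun (r s : ℝ) ↦ -(c₁ / (T' - s)) * r + C₃ * (T' - s) ^ (τ - 3))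
      (univ ×ˢ Icc 0 w) := by
  intro p hp
  have hne : T' - p.2 ≠ 0 := by
    have := hp.2.2
    exact (sub_pos.2 (this.trans_lt hw)).ne'
  have hd : ContDiffAt ℝ 1 (fun q : ℝ × ℝ ↦ T' - q.2) p := contDiffAt_const.sub contDiffAt_snd
  have h : ContDiffAt ℝ 1
      (fun q : ℝ × ℝ ↦ -(c₁ / (T' - q.2)) * q.1 + C₃ * (T' - q.2) ^ (τ - 3)) p :=
    (((contDiffAt_const.div hd hne).neg).mul contDiffAt_fst).add
      (contDiffAt_const.mul (hd.rpow_const_of_ne hne))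
  exact h.contDiffWithinAt

/-- From `F = V/R + N|E|² ≤ C₄ d^{τ−2}` and `dR ≤ c₂`: `V ≤ RF ≤ c₂ C₄ d^{τ−3}`
(Hamilton 1982, §17, last line of the proof of Lemma 17.4). [cite: Hamilton1982, §17, Lemma 17.4] -/
theorem gradSq_le_of_window {R V E₂ Nc C₄ c₂ d τ : ℝ} (hR : 0 < R) (hd : 0 < d)
    (hRc : d * R ≤ c₂) (hE : 0 ≤ E₂) (hNc : 0 ≤ Nc) (hC₄ : 0 ≤ C₄)
    (hF : V / R + Nc * E₂ ≤ C₄ * d ^ (τ - 2)) : V ≤ c₂ * C₄ * d ^ (τ - 3) := by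
  have hX : 0 < d ^ (τ - 2) := Real.rpow_pos_of_pos hd _
  have h1 : V ≤ C₄ * d ^ (τ - 2) * R := by
    rw [← div_le_iff₀ hR]
    linarith [mul_nonneg hNc hE]
  have h2 : C₄ * d ^ (τ - 2) * R ≤ C₄ * d ^ (τ - 2) * (c₂ / d) :=
    mul_le_mul_of_nonneg_left (by rw [le_div_iff₀ hd]; linarith) (by positivity)
  have h3 : d ^ (τ - 3) = d ^ (τ - 2) / d := by
    rw [show τ - 3 = τ - 2 - 1 by ring, Real.rpow_sub_one hd.ne']
  rw [h3]
  calc V ≤ C₄ * d ^ (τ - 2) * (c₂ / d) := h1.trans h2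
    _ = c₂ * C₄ * (d ^ (τ - 2) / d) := by ring

end RealLemmas

/-! ### The endgame of Lemma 17.4 -/

/-- **HELPER H4 — Hamilton 1982, Lemma 17.4 (decay of `|∇R|` under the Type-I sandwich), the
weak-maximum-principle endgame.** Along a Ricci flow on `[0, T)` on a closed 4-manifold with the
invariant pinching `m ≤ R`, `|W|² + 2|E|² ≤ K R^{2−τ}` (`0 < τ ≤ 1`), GIVEN the space-time
regularity of `R`, `|∇R|²`, `|Ric|²` along every restarted flow `s ↦ g(s + t₁)` on `M × [0, w]`
and Hamilton's evolution inequality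
`∂ₛF ≤ ΔF − |∇R|² + 180(1+Λ)(64|Rm| + R)|E|²` for `F = |∇R|²/R + 180(1+Λ)|E|²` wherever
`|E|² ≤ ΛR²`: if `c₁ ≤ (T−t)R ≤ c₂` on `[t₁, T)` (`c₁ > 0`), then
`|∇R|² ≤ C (T−t)^{δ−3}` on `[t₁, T)` with `δ = τ > 0`. Proof: module docstring
(`tracefree_le_mul_sq`, `reaction_bound`, `weakMaximumPrinciple` with `decay_comparison` and
`contDiffOn_decayODE`, `gradSq_le_of_window`). [cite: Hamilton1982, §17, Lemma 17.4] -/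
theorem helper_gradientDecay_of_evolution : ∀ (M : Type) [TopologicalSpace M] [T2Space M] [SecondCountableTopology M] [ChartedSpace (EuclideanSpace ℝ (Fin 4)) M] [IsManifold (𝓡 4) ∞ M] [CompactSpace M] (g : ℝ → PseudoRiemannianMetric (𝓡 4) ∞ (EuclideanSpace ℝ (Fin 4)) (TangentSpace (𝓡 4) : M → Type _)) (cov : ℝ → CovariantDerivative (𝓡 4) (EuclideanSpace ℝ (Fin 4)) (TangentSpace (𝓡 4) : M → Type _)) (T m K τ : ℝ), 0 < T → 0 < m → 0 < K → 0 < τ → τ ≤ 1 → IsRicciFlow g cov (Ico 0 T) → (∀ t ∈ Ico 0 T, (g t).IsRiemannian) → (∀ t ∈ Ico 0 T, ∀ [(g t).HasLeviCivita] (x : M), m ≤ (g t).scalarCurvature x ∧ (g t).weylNormSq x + 2 * (g t).tracelessRicciNormSq x ≤ K * (g t).scalarCurvature x ^ (2 - τ)) → (∀ t₁ w : ℝ, 0 ≤ t₁ → 0 < w → t₁ + w < T → ContMDiffOn ((𝓡 4).prod 𝓘(ℝ, ℝ)) 𝓘(ℝ, ℝ) ∞ (fun p : M × ℝ ↦ (g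 (p.2 + t₁)).scalarCurvatureWith (cov (p.2 + t₁)) p.1) (univ ×ˢ Icc 0 w)) → (∀ t₁ w : ℝ, 0 ≤ t₁ → 0 < w → t₁ + w < T → ContMDiffOn ((𝓡 4).prod 𝓘(ℝ, ℝ)) 𝓘(ℝ, ℝ) ∞ (fun p : M × ℝ ↦ (g (p.2 + t₁)).gradSq (fun y ↦ (g (p.2 + t₁)).scalarCurvatureWith (cov (p.2 + t₁)) y) p.1) (univ ×ˢ Icc 0 w)) → (∀ t₁ w : ℝ, 0 ≤ t₁ → 0 < w → t₁ + w < T → ContMDiffOn ((𝓡 4).prod 𝓘(ℝ, ℝ)) 𝓘(ℝ, ℝ) ∞ (fun p : M × ℝ ↦ (g (p.2 + t₁)).normSq p.1 ((cov (p.2 + t₁)).ricci p.1)) (univ ×ˢ Icc 0 w)) → (∀ (Λ t₁ w : ℝ), 0 ≤ Λ → 0 ≤ t₁ → 0 < w → t₁ + w < T → ∀ s ∈ Icc 0 w, ∀ x : M, (g (s + t₁)).normSq x ((cov (s + t₁)).ricci x) - (g (s + t₁)).scalarCurvatureWith (cov (s + t₁)) x ^ 2 / 4 ≤ Λ * (g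 (s + t₁)).scalarCurvatureWith (cov (s + t₁)) x ^ 2 → derivWithin (fun r ↦ (g (r + t₁)).gradSq (fun y ↦ (g (r + t₁)).scalarCurvatureWith (cov (r + t₁)) y) x / (g (r + t₁)).scalarCurvatureWith (cov (r + t₁)) x + 180 * (1 + Λ) * ((g (r + t₁)).normSq x ((cov (r + t₁)).ricci x) - (g (r + t₁)).scalarCurvatureWith (cov (r + t₁)) x ^ 2 / 4)) (Icc 0 w) s ≤ (g (s + t₁)).laplaceBeltrami (fun y ↦ (g (s + t₁)).gradSq (fun z ↦ (g (s + t₁)).scalarCurvatureWith (cov (s + t₁)) z) y / (g (s + t₁)).scalarCurvatureWith (cov (s + t₁)) y + 180 * (1 + Λ) * ((g (s + t₁)).normSq y ((cov (s + t₁)).ricci y) - (g (s + t₁)).scalarCurvatureWith (cov (s + t₁)) y ^ 2 / 4)) x + (-(g (s + t₁)).gradSq (fun y ↦ (g (s + t₁)).scalarCurvatureWith (cov (s + t₁)) y) x + 180 * (1 + Λ) * (64 * Real.sqrt ((g (s + t₁)).curvNormSqWith (cov (s + t₁)) x) + (g (s + t₁)).scalarCurvatureWith (cov (s + t₁)) x)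 * ((g (s + t₁)).normSq x ((cov (s + t₁)).ricci x) - (g (s + t₁)).scalarCurvatureWith (cov (s + t₁)) x ^ 2 / 4))) → ∀ (t₁ c₁ c₂ : ℝ), t₁ ∈ Ico 0 T → 0 < c₁ → (∀ t ∈ Ico t₁ T, ∀ x : M, c₁ ≤ (T - t) * (g t).scalarCurvatureWith (cov t) x ∧ (T - t) * (g t).scalarCurvatureWith (cov t) x ≤ c₂) → ∃ δ C : ℝ, 0 < δ ∧ ∀ t ∈ Ico t₁ T, ∀ x : M, (g t).gradSq (fun y ↦ (g t).scalarCurvatureWith (cov t) y) x ≤ C * (T - t) ^ (δ - 3) := by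
  intro M _ _ _ _ _ _ g cov T m K τ hT hm hK hτ0 hτ1 hflow hRiem hpinch hRreg hVreg hNreg hev t₁ c₁
    c₂ ht₁ hc₁ hsand
  -- the pinching dictionary along the flow and `|E|² ≤ Λ R²`
  have hdict := fun {t : ℝ} (ht : t ∈ Ico 0 T) (x : M) ↦
    roundness_dictionary hflow hRiem hpinch ht x
  obtain ⟨Λ, hΛ0, hΛE⟩ : ∃ Λ : ℝ, 0 ≤ Λ ∧ ∀ t ∈ Ico 0 T, ∀ x : M,
      (g t).normSq x ((cov t).ricci x) - (g t).scalarCurvatureWith (cov t) x ^ 2 / 4 ≤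
        Λ * (g t).scalarCurvatureWith (cov t) x ^ 2 := by
    refine ⟨K * m ^ (-τ) / 2, by positivity, fun t ht x ↦ ?_⟩
    obtain ⟨hmR, -, hW, hp⟩ := hdict ht x
    exact tracefree_le_mul_sq hm hK.le hτ0.le hmR hW hp
  -- the reaction constant
  obtain ⟨C₃, hC₃0, hreact⟩ := reaction_bound c₂ hm hK hτ0 hτ1 hΛ0 hc₁
  -- Hamilton's function along the flow restarted at `t₁`
  obtain ⟨u, hu⟩ : ∃ u : ℝ → M → ℝ, u = fun s y ↦
      (g (s + t₁)).gradSq (fun z ↦ (g (s + t₁)).scalarCurvatureWith (cov (s + t₁)) z) y /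
          (g (s + t₁)).scalarCurvatureWith (cov (s + t₁)) y +
        180 * (1 + Λ) * ((g (s + t₁)).normSq y ((cov (s + t₁)).ricci y) -
          (g (s + t₁)).scalarCurvatureWith (cov (s + t₁)) y ^ 2 / 4) := ⟨_, rfl⟩
  -- its regularity on every window `M × [0, w]`
  have hureg : ∀ w : ℝ, 0 < w → t₁ + w < T →
      ContMDiffOn ((𝓡 4).prod 𝓘(ℝ, ℝ)) 𝓘(ℝ, ℝ) ∞ (fun p : M × ℝ ↦ u p.2 p.1) (univ ×ˢ Icc 0 w) := by
    intro w hw hwT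
    have HR := hRreg t₁ w ht₁.1 hw hwT
    have HV := hVreg t₁ w ht₁.1 hw hwT
    have HN := hNreg t₁ w ht₁.1 hw hwT
    have hne : ∀ p ∈ univ ×ˢ Icc (0 : ℝ) w,
        (g ((p : M × ℝ).2 + t₁)).scalarCurvatureWith (cov (p.2 + t₁)) p.1 ≠ 0 := by
      intro p hp
      have hmem : p.2 + t₁ ∈ Ico 0 T := ⟨by linarith [hp.2.1, ht₁.1], by linarith [hp.2.2]⟩
      exact (hm.trans_le (hdict hmem p.1).1).ne'
    rw [hu]
    exact (HV.div₀ HR hne).add (contMDiffOn_const.mul (HN.sub ((HR.pow 2).div_const 4)))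
  -- the initial bound `α`
  have hT' : 0 < T - t₁ := sub_pos.2 ht₁.2
  have hw₀ : 0 < (T - t₁) / 2 := by positivity
  have hw₀T : t₁ + (T - t₁) / 2 < T := by linarith
  have hcont : Continuous (u 0) :=
    (contMDiff_slice (hureg _ hw₀ hw₀T) (t := 0) ⟨le_rfl, hw₀.le⟩).continuous
  obtain ⟨α, hα⟩ := (isCompact_range hcont).bddAbove
  have hu0 : ∀ x : M, u 0 x ≤ α := fun x ↦ hα (mem_range_self x)
  -- the comparison function and the right-hand side of the ODE
  obtain ⟨φ, C₄, hφ0, hC₄0, hφd, hφle⟩ := decay_comparison hT' hc₁ hτ1 hC₃0 α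
  obtain ⟨Fo, hFo⟩ : ∃ Fo : ℝ → ℝ → ℝ,
      Fo = fun r s ↦ -(c₁ / (T - t₁ - s)) * r + C₃ * (T - t₁ - s) ^ (τ - 3) := ⟨_, rfl⟩
  -- KEY: `F(t, x) ≤ C₄ (T - t)^{τ-2}` on `[t₁, T)`
  have hFle : ∀ t ∈ Ico t₁ T, ∀ x : M, u (t - t₁) x ≤ C₄ * (T - t) ^ (τ - 2) := by
    intro t ht x
    rcases ht.1.eq_or_lt with heq | hlt
    · subst heq
      rw [sub_self]
      calc u 0 x ≤ α := hu0 x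
        _ = φ 0 := hφ0.symm
        _ ≤ C₄ * (T - t₁ - 0) ^ (τ - 2) := hφle 0 le_rfl hT'
        _ = C₄ * (T - t₁) ^ (τ - 2) := by rw [sub_zero]
    -- the weak maximum principle on the window `[0, t - t₁]` for the restarted flow
    have hw0 : 0 < t - t₁ := sub_pos.2 hlt
    have hwT : t₁ + (t - t₁) < T := by linarith [ht.2]
    have hwT' : t - t₁ < T - t₁ := by linarith [ht.2]
    have hmem : ∀ s ∈ Icc 0 (t - t₁), s + t₁ ∈ Ico t₁ T ∧ s + t₁ ∈ Ico 0 T := fun s hs ↦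
      ⟨⟨by linarith [hs.1], by linarith [hs.2]⟩, ⟨by linarith [hs.1, ht₁.1], by linarith [hs.2]⟩⟩
    have hR' : ∀ s ∈ Icc 0 (t - t₁), (g (s + t₁)).IsRiemannian := fun s hs ↦
      hRiem _ (hmem s hs).2
    have hFo' : ContDiffOn ℝ 1 (uncurry Fo) (univ ×ˢ Icc 0 (t - t₁)) := by
      rw [hFo]
      exact contDiffOn_decayODE hwT'
    have hφw : ∀ s ∈ Icc 0 (t - t₁), HasDerivWithinAt φ (Fo (φ s) s) (Icc 0 (t - t₁)) s := by
      intro s hs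
      rw [hFo]
      exact (hφd s (hs.2.trans_lt hwT')).hasDerivWithinAt
    have hineq : ∀ s ∈ Icc 0 (t - t₁), ∀ y : M,
        derivWithin (fun r ↦ u r y) (Icc 0 (t - t₁)) s ≤
          (g (s + t₁)).laplaceBeltrami (u s) y +
            mvfderiv (𝓡 4) (u s) y ((fun (_ : ℝ) (z : M) ↦ (0 : TangentSpace (𝓡 4) z)) s y) +
            Fo (u s y) s := by
      intro s hs y
      obtain ⟨hst, hst'⟩ := hmem s hs
      obtain ⟨hmR, hE, hW, hp⟩ := hdict hst' y
      have hV0 := (g (s + t₁)).gradSq_nonneg (hRiem _ hst')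
        (fun z ↦ (g (s + t₁)).scalarCurvatureWith (cov (s + t₁)) z) y
      have hsd := hsand (s + t₁) hst y
      have hTs : T - (s + t₁) = T - t₁ - s := by ring
      rw [hTs] at hsd
      have hd : 0 < T - t₁ - s := by linarith [hs.2]
      have h1 := hev Λ t₁ (t - t₁) hΛ0 ht₁.1 hw0 hwT s hs y (hΛE _ hst' y)
      have h2 := hreact _ _ _ _ _ hmR hV0 hE hW hp hd hsd.1 hsd.2
      simp only [hu, hFo, map_zero, add_zero]
      linarith
    have key := weakMaximumPrinciple hw0 hR' (fun (_ : ℝ) (z : M) ↦ (0 : TangentSpace (𝓡 4) z))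
      hFo' (hureg _ hw0 hwT) hineq hφw hφ0 hu0 (t - t₁) ⟨hw0.le, le_rfl⟩ x
    have hTt : T - t₁ - (t - t₁) = T - t := by ring
    calc u (t - t₁) x ≤ φ (t - t₁) := key
      _ ≤ C₄ * (T - t₁ - (t - t₁)) ^ (τ - 2) := hφle _ hw0.le hwT'
      _ = C₄ * (T - t) ^ (τ - 2) := by rw [hTt]
  -- conclusion: `|∇R|² ≤ R F ≤ c₂ C₄ (T - t)^{τ-3}`
  refine ⟨τ, c₂ * C₄, hτ0, fun t ht x ↦ ?_⟩
  have ht' : t ∈ Ico 0 T := ⟨ht₁.1.trans ht.1, ht.2⟩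
  obtain ⟨hmR, hE, -, -⟩ := hdict ht' x
  have hF := hFle t ht x
  simp only [hu, sub_add_cancel] at hF
  exact gradSq_le_of_window (hm.trans_le hmR) (sub_pos.2 ht.2) (hsand t ht x).2 hE (by positivity)
    hC₄0 hF

end Summit.SmoothPoincare4.SmoothPoincare4.Theorems.MargerinRails

end
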